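import Literature.Probability.RandomPlanarGeometry.ContinuousPathProjection
import Literature.Probability.RandomPlanarGeometry.CurveClassStopAtMeasurable
import HarnessLib

/-!
# A measurable projection onto continuous complex paths; continuity of stopping a path

Two measure-theoretic utilities for laws of stopped random paths (used to transport in law the
curve class of an SLE trace stopped at a random time, `SLESixMoebiusLocality*`):

* `exists_measurable_continuousMap_projC` — the complex-valued twin of
  `exists_measurable_continuousMap_proj` (`ContinuousPathProjection.lean`): a map
  `P : (ℝ≥0 → ℂ) → C(ℝ≥0, ℂ)`, measurable from the product σ-algebra to the Borel σ-algebra of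
  the compact-open topology (scoped instances `PathBorel`), with `P W = W` for continuous `W`
  (Lusin–Souslin: sampling along a dense sequence is an injective continuous map of a Polish
  space, hence a measurable embedding with a measurable left inverse);
* `continuous_stopPathFun`, `continuous_mk_stopPath` — stopping a continuous path `γ` at the
  time `τ`, `(γ, τ) ↦ (s ↦ γ(τ s)) ∈ C([0,1], ℂ)`, is jointly continuous for the compact-open
  topology (evaluation is continuous on a locally compact space), and so is its curve class
  `(γ, τ) ↦ [s ↦ γ(τ s)] ∈ CurveClass ℂ`.

## References

* A. S. Kechris, *Classical Descriptive Set Theory*, Springer (1995), Thm. 15.1.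
* P. Billingsley, *Convergence of Probability Measures*, 2nd ed. (1999), §7.
-/

noncomputable section

open Set Filter Topology MeasureTheory TopologicalSpace
open scoped NNReal unitInterval

namespace Literature.Probability.RandomPlanarGeometry

open scoped PathBorel

/-! ### The measurable projection onto continuous complex paths -/

/-- **Sampling a continuous complex path along a dense sequence is a measurable embedding** of
`C(ℝ≥0, ℂ)` into `ℕ → ℂ` (continuous, injective on a Polish space; Lusin–Souslin). [folklore] -/
theorem measurableEmbedding_samplePathC :
    MeasurableEmbedding fun (W : C(ℝ≥0, ℂ)) (k : ℕ) ↦ W (denseSeq ℝ≥0 k) := by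
  have hc : Continuous fun (W : C(ℝ≥0, ℂ)) (k : ℕ) ↦ W (denseSeq ℝ≥0 k) :=
    continuous_pi fun k ↦ continuous_eval_const (denseSeq ℝ≥0 k)
  have hi : Function.Injective fun (W : C(ℝ≥0, ℂ)) (k : ℕ) ↦ W (denseSeq ℝ≥0 k) := by
    intro W₁ W₂ h
    refine ContinuousMap.ext fun t ↦ ?_
    have hEq : EqOn W₁ W₂ (range (denseSeq ℝ≥0)) := by
      rintro _ ⟨k, rfl⟩
      exact congr_fun h k
    exact congr_fun
      (Continuous.ext_on (denseRange_denseSeq ℝ≥0) W₁.continuous W₂.continuous hEq) t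
  exact hc.measurableEmbedding hi

/-- **A measurable projection of the raw complex path space onto continuous paths**: there is
`P : (ℝ≥0 → ℂ) → C(ℝ≥0, ℂ)`, measurable from the product σ-algebra to the Borel σ-algebra of
locally uniform convergence, with `P W = W` for every continuous `W` (a measurable left inverse
of `measurableEmbedding_samplePathC` precomposed with sampling). [folklore] -/
theorem exists_measurable_continuousMap_projC :
    ∃ P : (ℝ≥0 → ℂ) → C(ℝ≥0, ℂ), Measurable P ∧ ∀ W : C(ℝ≥0, ℂ), P W = W := by
  have he := measurableEmbedding_samplePathC
  set P₀ : (ℕ → ℂ) → C(ℝ≥0, ℂ) :=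
    Function.extend (fun (W : C(ℝ≥0, ℂ)) (k : ℕ) ↦ W (denseSeq ℝ≥0 k)) id fun _ ↦ 0 with hP₀
  have hP₀ : Measurable P₀ := he.measurable_extend measurable_id measurable_const
  have hs : Measurable fun (W : ℝ≥0 → ℂ) (k : ℕ) ↦ W (denseSeq ℝ≥0 k) :=
    measurable_pi_lambda _ fun k ↦ measurable_pi_apply _
  refine ⟨fun W ↦ P₀ fun k ↦ W (denseSeq ℝ≥0 k), hP₀.comp hs, fun W ↦ ?_⟩
  exact he.injective.extend_apply _ _ W

/-! ### Stopping a continuous path at a time: joint continuity -/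

/-- The stopped-path function `((γ, τ), s) ↦ γ(τ s)` is jointly continuous on
`(C(ℝ≥0, ℂ) × ℝ≥0) × [0, 1]` (evaluation `C(ℝ≥0, ℂ) × ℝ≥0 → ℂ` is continuous, `ℝ≥0` being locally
compact). [folklore] -/
theorem continuous_stopPathFun :
    Continuous fun q : (C(ℝ≥0, ℂ) × ℝ≥0) × I ↦ q.1.1 (((q.1.2 : ℝ) * q.2).toNNReal) := by
  have h1 : Continuous fun q : (C(ℝ≥0, ℂ) × ℝ≥0) × I ↦ q.1.1 := continuous_fst.comp continuous_fst
  have h2 : Continuous fun q : (C(ℝ≥0, ℂ) × ℝ≥0) × I ↦ (((q.1.2 : ℝ) * q.2).toNNReal : ℝ≥0) :=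
    continuous_real_toNNReal.comp ((NNReal.continuous_coe.comp (continuous_snd.comp
      continuous_fst)).mul (continuous_subtype_val.comp continuous_snd))
  exact continuous_eval.comp (h1.prodMk h2)

/-- **Stopping is jointly continuous into `C([0, 1], ℂ)`**: the map
`(γ, τ) ↦ (s ↦ γ(τ s))` from `C(ℝ≥0, ℂ) × ℝ≥0` to `C([0,1], ℂ)` (uniform topology) is continuous.
[folklore] -/
theorem continuous_stopPath :
    Continuous fun q : C(ℝ≥0, ℂ) × ℝ≥0 ↦
      (⟨fun s : I ↦ q.1 (((q.2 : ℝ) * s).toNNReal), q.1.continuous.comp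
        (continuous_real_toNNReal.comp (continuous_const.mul continuous_subtype_val))⟩ :
        C(I, ℂ)) :=
  ContinuousMap.continuous_of_continuous_uncurry _ continuous_stopPathFun

/-- **The curve class of a stopped continuous path depends continuously on (path, time).**
[folklore] -/
theorem continuous_mk_stopPath :
    Continuous fun q : C(ℝ≥0, ℂ) × ℝ≥0 ↦ CurveClass.mk (Curve.mk
      (⟨fun s : I ↦ q.1 (((q.2 : ℝ) * s).toNNReal), q.1.continuous.comp
        (continuous_real_toNNReal.comp (continuous_const.mul continuous_subtype_val))⟩ :
        C(I, ℂ))) :=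
  CurveClass.continuous_mk_comp_mk.comp continuous_stopPath

end Literature.Probability.RandomPlanarGeometry

end
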